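import Literature.IUT.LogThetaLattice.HolomorphicHull
import HarnessLib

/-!
# [IUTchIII] Remark 3.9.5 (vi): the "only if" half of the `⊼`-criterion for hull-sets — PROVED
# (proof-only companion of `HolomorphicHull.lean`; abc-iut cell, layer L6, slice [IUTchIII] §3)

S. Mochizuki, *Inter-universal Teichmüller theory III*, kurims manuscript (May 2020), §3, Remark 3.9.5 (v)–(vi),
pp. 129–130 [claim: Mochizuki2012, status: disputed]: (v) for a set `E` and a subset `S ⊆ E`, "`E ⊼ S := (E ∖ S) ∐ {S}`,
the quotient of `E` obtained by identifying the elements of `S` and leaving `E ∖ S` unaffected"; (vi) taking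
`S := φ(P) ⊆ 𝓘^ℚ((−))`, "images of distinct `H₁, H₂ ∈ Hul` map to the same subset of `𝓘^ℚ((−)) ⊼ φ(P)` if and only
if `H₁, H₂ ⊆ φ(P)`". abc-iut-L6-t4's statement file `HolomorphicHull.lean` (p404101) DEFINES `E ⊼ S` (`Upper S`,
`Upper.mk S : E → E ⊼ S`, relation `upperRel S`), PROVES the "if" half (`Upper.image_eq_image`) and records the
"only if" half — "which uses the shape of hull-sets" — as the named statement `Remark395vi_onlyIf Hul φP`.

This file PROVES the "only if" half:

* `upperRel_equivalence`, `Upper.mk_eq_mk_iff` — `upperRel S` (`x = y ∨ (x ∈ S ∧ y ∈ S)`) is already an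
  equivalence relation, so two points have the same image in `E ⊼ S` iff they are equal or both lie in `S`;
  `Upper.diff_eq_of_image_eq` — subsets with the same image in `E ⊼ S` agree OUTSIDE `S`;
* **`Remark395vi_onlyIf_of_add_sub_closed`** — the printed "only if" for ANY family `Hul` of subsets of an
  additive commutative group that are closed under `+` and `−`, and any `φ(P)` closed under `−`: if `H₁ ≠ H₂` in
  `Hul` had the same image in `X ⊼ φ(P)` but were not both inside `φ(P)`, their common part `T = H_i ∖ φ(P)` would be
  nonempty, and translating by `t ∈ T` shows `H₁ = H₂` (the "shape of hull-sets" used is exactly this additive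
  closure);
* `IsHullSet.add_mem` / `IsHullSet.sub_mem` / `IsHullSet.zero_mem` — hull-sets `Π_i λ_i · 𝒪_{k_i}` (Rmk. 3.9.5 (i))
  are closed under `+`, `−` and contain `0`; hence **`Remark395vi_onlyIf_hullSets`**: `Remark395vi_onlyIf Hul φ(P)`
  HOLDS for `Hul :=` the hull-sets of `𝓘^ℚ((−)) ≅ ⊕_i k_i` and ANY hull-set `φ(P)` (in print `φ(P) ∈ Hul` is the
  holomorphic hull of `P`).

No new definitions; elementary set theory and additive bookkeeping; nothing here bears on the disputed
[IUTchIII] Cor. 3.12 or takes a side; typed ≠ discharged elsewhere.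
-/

namespace Literature.IUT.LogThetaLattice

universe u v

/-! ### (v) the relation `upperRel` is an equivalence; images in `E ⊼ S` -/

section UpperFacts

variable {E : Type u} (S : Set E)

/-- The identification relation of `E ⊼ S` ([IUTchIII] Rmk. 3.9.5 (v) p. 129) is an equivalence relation.
[claim: Mochizuki2012, status: disputed] -/
theorem upperRel_equivalence : Equivalence (upperRel S) where
  refl _ := Or.inl rfl
  symm := by
    rintro x y (rfl | ⟨hx, hy⟩)
    · exact Or.inl rfl
    · exact Or.inr ⟨hy, hx⟩
  trans := by
    rintro x y z (rfl | ⟨hx, hy⟩) (rfl | ⟨hy', hz⟩)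
    · exact Or.inl rfl
    · exact Or.inr ⟨hy', hz⟩
    · exact Or.inr ⟨hx, hy⟩
    · exact Or.inr ⟨hx, hz⟩

/-- Two points of `E` have the same image in `E ⊼ S` iff they are equal or both lie in `S` ([IUTchIII] Rmk. 3.9.5
(v) p. 129 "identifying the elements of `S` and leaving `E ∖ S` unaffected"). [claim: Mochizuki2012, status: disputed] -/
theorem Upper.mk_eq_mk_iff (x y : E) : Upper.mk S x = Upper.mk S y ↔ x = y ∨ (x ∈ S ∧ y ∈ S) := by
  constructor
  · intro h
    exact ((upperRel_equivalence S).eqvGen_iff).mp (Quot.eqvGen_exact h)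
  · intro h
    exact Quot.sound h

/-- Subsets with the same image in `E ⊼ S` agree outside `S` ([IUTchIII] Rmk. 3.9.5 (v)–(vi) pp. 129–130).
[claim: Mochizuki2012, status: disputed] -/
theorem Upper.diff_eq_of_image_eq {H₁ H₂ : Set E} (h : Upper.mk S '' H₁ = Upper.mk S '' H₂) :
    H₁ \ S = H₂ \ S := by
  have key : ∀ {A B : Set E}, Upper.mk S '' A = Upper.mk S '' B → A \ S ⊆ B \ S := by
    intro A B hAB x ⟨hxA, hxS⟩
    have hx : Upper.mk S x ∈ Upper.mk S '' B := hAB ▸ Set.mem_image_of_mem _ hxA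
    obtain ⟨y, hyB, hyx⟩ := hx
    rcases (Upper.mk_eq_mk_iff S y x).mp hyx with rfl | ⟨-, hxS'⟩
    · exact ⟨hyB, hxS⟩
    · exact absurd hxS' hxS
  exact Set.Subset.antisymm (key h) (key h.symm)

end UpperFacts

/-! ### (vi) the "only if" half, from additive closure ("the shape of hull-sets") -/

section OnlyIf

variable {X : Type u} [AddCommGroup X]

/-- Translation argument behind [IUTchIII] Rmk. 3.9.5 (vi) p. 130: if `A` is closed under `+`, `B` under `−`,
`S` under `−`, `A` and `B` agree outside `S`, and `A ∖ S` is inhabited, then `A ⊆ B`. [folklore] -/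
private theorem subset_of_diff_eq {A B S : Set X} (hA : ∀ x ∈ A, ∀ y ∈ A, x + y ∈ A)
    (hB : ∀ x ∈ B, ∀ y ∈ B, x - y ∈ B) (hS : ∀ x ∈ S, ∀ y ∈ S, x - y ∈ S) (hdiff : A \ S = B \ S)
    {t : X} (ht : t ∈ A \ S) : A ⊆ B := by
  intro h hh
  have hAB : ∀ {z : X}, z ∈ A \ S → z ∈ B := fun {z} hz => by
    have hz' : z ∈ B \ S := by rw [← hdiff]; exact hz
    exact hz'.1
  by_cases hhS : h ∈ S
  · have htB : t ∈ B := hAB ht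
    have hsum : h + t ∈ A \ S := by
      refine ⟨hA h hh t ht.1, fun hmem => ht.2 ?_⟩
      have := hS (h + t) hmem h hhS
      rwa [add_sub_cancel_left] at this
    have hsumB : h + t ∈ B := hAB hsum
    have := hB (h + t) hsumB t htB
    rwa [add_sub_cancel_right] at this
  · exact hAB ⟨hh, hhS⟩

/-- **IUTchIII:Rmk3.9.5(vi)** (kurims p. 130), the "only if" half PROVED from additive closure: for a family `Hul`
of subsets of an additive commutative group each closed under `+` and `−`, and `φ(P)` closed under `−`, "images
of distinct `H₁, H₂ ∈ Hul` map to the same subset of `X ⊼ φ(P)` ONLY IF `H₁, H₂ ⊆ φ(P)`" — abc-iut-L6-t4's named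
statement `Remark395vi_onlyIf Hul φP` HOLDS. [claim: Mochizuki2012, status: disputed] -/
theorem Remark395vi_onlyIf_of_add_sub_closed {Hul : Set (Set X)} {φP : Set X}
    (hHul : ∀ H ∈ Hul, (∀ x ∈ H, ∀ y ∈ H, x + y ∈ H) ∧ (∀ x ∈ H, ∀ y ∈ H, x - y ∈ H))
    (hφ : ∀ x ∈ φP, ∀ y ∈ φP, x - y ∈ φP) : Remark395vi_onlyIf Hul φP := by
  intro H₁ h₁ H₂ h₂ hne himg
  have hdiff : H₁ \ φP = H₂ \ φP := Upper.diff_eq_of_image_eq φP himg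
  by_contra hnot
  -- the common part outside `φ(P)` is inhabited
  have hT : (H₁ \ φP).Nonempty := by
    by_contra hempty
    rw [Set.not_nonempty_iff_eq_empty] at hempty
    have hsub₁ : H₁ ⊆ φP := Set.sdiff_eq_empty.mp hempty
    have hsub₂ : H₂ ⊆ φP := Set.sdiff_eq_empty.mp (hdiff ▸ hempty)
    exact hnot ⟨hsub₁, hsub₂⟩
  obtain ⟨t, ht⟩ := hT
  apply hne
  exact Set.Subset.antisymm
    (subset_of_diff_eq (hHul H₁ h₁).1 (hHul H₂ h₂).2 hφ hdiff ht)
    (subset_of_diff_eq (hHul H₂ h₂).1 (hHul H₁ h₁).2 hφ hdiff.symm (by rw [← hdiff]; exact ht))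

end OnlyIf

/-! ### Hull-sets are additively closed; the "only if" half for hull-sets -/

section HullSets

variable {ι : Type u} {k : ι → Type v} [∀ i, Field (k i)] (O : ∀ i, Subring (k i))

/-- A hull-set `Π_i λ_i · 𝒪_{k_i}` ([IUTchIII] Rmk. 3.9.5 (i) p. 127) is closed under addition.
[claim: Mochizuki2012, status: disputed] -/
theorem IsHullSet.add_mem {H : Set (∀ i, k i)} (hH : IsHullSet O H) {x y : ∀ i, k i} (hx : x ∈ H)
    (hy : y ∈ H) : x + y ∈ H := by
  obtain ⟨lam, -, rfl⟩ := hH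
  intro i _
  obtain ⟨a, ha, hax⟩ := hx i (Set.mem_univ i)
  obtain ⟨b, hb, hby⟩ := hy i (Set.mem_univ i)
  exact ⟨a + b, (O i).add_mem ha hb, by simp only [Pi.add_apply, ← hax, ← hby, mul_add]⟩

/-- A hull-set `Π_i λ_i · 𝒪_{k_i}` is closed under subtraction. [claim: Mochizuki2012, status: disputed] -/
theorem IsHullSet.sub_mem {H : Set (∀ i, k i)} (hH : IsHullSet O H) {x y : ∀ i, k i} (hx : x ∈ H)
    (hy : y ∈ H) : x - y ∈ H := by
  obtain ⟨lam, -, rfl⟩ := hH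
  intro i _
  obtain ⟨a, ha, hax⟩ := hx i (Set.mem_univ i)
  obtain ⟨b, hb, hby⟩ := hy i (Set.mem_univ i)
  exact ⟨a - b, (O i).sub_mem ha hb, by simp only [Pi.sub_apply, ← hax, ← hby, mul_sub]⟩

/-- A hull-set contains `0`. [claim: Mochizuki2012, status: disputed] -/
theorem IsHullSet.zero_mem {H : Set (∀ i, k i)} (hH : IsHullSet O H) : (0 : ∀ i, k i) ∈ H := by
  obtain ⟨lam, -, rfl⟩ := hH
  exact fun i _ => ⟨0, (O i).zero_mem, by simp⟩

/-- **IUTchIII:Rmk3.9.5(vi)** (kurims p. 130) "images of distinct `H₁, H₂ ∈ Hul` map to the same subset of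
`𝓘^ℚ((−)) ⊼ φ(P)` if and only if `H₁, H₂ ⊆ φ(P)`" — the "ONLY IF" half PROVED for the hull-sets of
`𝓘^ℚ((−)) ≅ ⊕_i k_i` (Rmk. 3.9.5 (i)) and any hull-set `φ(P)` (in print the holomorphic hull of `P`): abc-iut-L6-t4's
`Remark395vi_onlyIf {H | IsHullSet O H} φP` HOLDS (the "if" half is `Upper.image_eq_image` of the statement
file). [claim: Mochizuki2012, status: disputed] -/
theorem Remark395vi_onlyIf_hullSets {φP : Set (∀ i, k i)} (hφ : IsHullSet O φP) :
    Remark395vi_onlyIf {H | IsHullSet O H} φP :=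
  Remark395vi_onlyIf_of_add_sub_closed
    (fun _ hH => ⟨fun _ hx _ hy => IsHullSet.add_mem O hH hx hy, fun _ hx _ hy => IsHullSet.sub_mem O hH hx hy⟩)
    fun _ hx _ hy => IsHullSet.sub_mem O hφ hx hy

end HullSets

end Literature.IUT.LogThetaLattice
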